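import Mathlib.RingTheory.Algebraic.Integral
import Mathlib.RingTheory.MvPolynomial.Tower
import Mathlib.RingTheory.AlgebraicIndependent.Transcendental
import Mathlib.Algebra.Order.Archimedean.Basic
import Mathlib.Topology.MetricSpace.Pseudo.Pi
import Literature.ModelTheory.ExponentialFields.DefinableClosureOrderedField
import Literature.ModelTheory.ExponentialFields.TarskiSeidenbergProofs
import Literature.NumberTheory.Transcendental.SemialgebraicAlgebraicPoints
import HarnessLib

/-!
# SoloInformed — transfer of real parameters to real-algebraic parameters

Solo programme `solo-KontsevichZagierPeriods-informed`, session s137, file 1: the kernel form of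
the TRANSFER STEP of the programme's `KZ_ℝ` METHOD BARRIER (paper `real-parameters.md`, VERDICT
§4) — a proof of the period conjecture must USE the arithmetic of the field of definition, since
for the same calculus with real parameters (`KZ_ℝ`, cf. `Literature.NumberTheory.Transcendental.
KZOver`) every first-order configuration of `ℝ`-semialgebraic data can be re-instantiated with
real-ALGEBRAIC parameters (`ℝ_alg ≼ ℝ`), which would force values such as `π` to be algebraic.
Elementary form; the only deep input is Tarski–Seidenberg (`tarski_seidenberg_real_holds`).

* `soloInformed_exists_algebraic_point` — **every non-empty `ℚ`-semialgebraic subset of `ℝⁿ`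
  contains a point with all coordinates algebraic over `ℚ`**; the same for `K`-semialgebraic
  sets, `K = ℚ̄ ∩ ℝ` realised as the subring `integralClosure ℚ ℝ`
  (`soloInformed_exists_algebraic_point_K`).  Induction on `n`: the projection is
  `K`-semialgebraic (Tarski–Seidenberg) and has an algebraic point `a`; the fibre over `a` is a
  non-empty `K`-semialgebraic subset of the line and contains an algebraic point, because at a
  point transcendental over `K` a `K`-semialgebraic subset of the line is a neighbourhood or a
  co-neighbourhood (`soloInformed_nhds_or_compl_mem_nhds_of_transcendental`).
* `soloInformed_realParameter_transfer` — the transfer principle: a `ℚ`-semialgebraic condition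
  on a real parameter vector that has a real solution has a solution in `(ℚ̄ ∩ ℝ)ᵐ`.
* `soloInformed_isSemialgebraic_real_iff_fibre` — **`ℝ`-semialgebraic sets are exactly the
  fibres `{x | (c, x) ∈ S}` of `ℚ`-semialgebraic families `S ⊆ ℝ^{m ⊕ n}` at real vectors `c`**.
* `soloInformed_exists_mem_forall_mem_definableClosure` — the model-theoretic form: in an
  o-minimal expansion of an ordered field a non-empty `A`-definable subset of `Mⁿ` has a point
  with all coordinates in `dcl(A)` (van den Dries 1998, Ch. 6 (1.2)–(1.3); den Besten 2016,
  Lemma 4.4.2; the tree's `exists_mem_definableClosure_of_nonempty_of_orderedField` is `n = 1`).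

So an `ℝ`-semialgebraic configuration is a `ℚ`-semialgebraic family plus ONE real vector `c`, and
when its validity is a `ℚ`-semialgebraic condition `V(c)` it is also realised by an algebraic `c'`.
The applications (no tame squaring of the disc, `KZ_ℝ`-inequivalence of equal values) are separate.

References: Bochnak–Coste–Roy, *Real Algebraic Geometry* (1998), §2.1–2.2 and §5.1–5.2;
Basu–Pollack–Roy, *Algorithms in Real Algebraic Geometry* (2006), §2.4–2.5 (semi-algebraic sets
over a subring, Thm. 2.80); van den Dries, *Tame topology and o-minimal structures* (1998), Ch. 6;
den Besten, *Wilkie's Theorem and the Uniform Real Schanuel Conjecture* (thesis, 2016), §4.4.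
-/

noncomputable section

namespace Summit.KontsevichZagierPeriods.KontsevichZagierPeriods.Theorems

open Set Filter Topology FirstOrder FirstOrder.Language
open Literature.ModelTheory.ExponentialFields Literature.NumberTheory.Transcendental

/-! ### Base change of the coefficient ring -/

/-- **Base change of coefficients along a tower `k → k' → R`**: a `k`-semialgebraic set is
`k'`-semialgebraic (map each generating polynomial to `k'[X]`; the tree's
`IsSemialgebraic.baseChange`, restated to keep imports small).
[cite: BochnakCosteRoy1998, Def. 2.1.4] -/
theorem soloInformed_isSemialgebraic_baseChange {k : Type*} (k' : Type*) {R ι : Type*}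
    [CommRing k] [CommRing k'] [CommRing R] [LT R] [Algebra k R] [Algebra k' R] [Algebra k k']
    [IsScalarTower k k' R] {s : Set (ι → R)} (hs : IsSemialgebraic k s) :
    IsSemialgebraic k' s := by
  induction hs using BooleanSubalgebra.closure_bot_sup_induction with
  | mem t ht =>
    rcases ht with ⟨p, rfl⟩ | ⟨p, rfl⟩
    · convert isSemialgebraic_setOf_eval_eq_zero (k := k') (R := R)
        (MvPolynomial.map (algebraMap k k') p) using 1
      ext x
      simp only [mem_setOf_eq, MvPolynomial.aeval_map_algebraMap]
    · convert isSemialgebraic_setOf_eval_pos (k := k') (R := R)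
        (MvPolynomial.map (algebraMap k k') p) using 1
      ext x
      simp only [mem_setOf_eq, MvPolynomial.aeval_map_algebraMap]
  | bot => exact isSemialgebraic_empty
  | sup t _ u _ iht ihu => exact iht.union ihu
  | compl t _ iht => exact iht.compl

/-! ### Semialgebraic subsets of the line at a point transcendental over the coefficients -/

section Line

variable {k : Type*} [CommRing k] [Algebra k ℝ]

/-- **Points transcendental over the coefficient ring are generic.** If `x 0` is transcendental
over `k`, every `k`-semialgebraic `s ⊆ ℝ¹` is a neighbourhood of `x` or has a neighbourhood of `x`
in its complement (a non-zero `p ∈ k[X]` does not vanish at `x`, so each generating sign condition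
is decided near `x` by continuity; the tree's `nhds_or_compl_mem_nhds_of_transcendental` is the
case `k = ℚ`, with the same proof). [cite: BochnakCosteRoy1998, §2.1] -/
theorem soloInformed_nhds_or_compl_mem_nhds_of_transcendental {x : Fin 1 → ℝ}
    (hx : Transcendental k (x 0)) {s : Set (Fin 1 → ℝ)} (hs : IsSemialgebraic k s) :
    s ∈ 𝓝 x ∨ sᶜ ∈ 𝓝 x := by
  have hinj : Function.Injective (MvPolynomial.aeval x : MvPolynomial (Fin 1) k →ₐ[k] ℝ) :=
    (algebraicIndependent_singleton_iff (R := k) (x := x) (0 : Fin 1)).2 hx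
  have hne : ∀ p : MvPolynomial (Fin 1) k, p ≠ 0 → MvPolynomial.aeval x p ≠ 0 := fun p hp h =>
    hp (hinj (by rw [h, map_zero]))
  induction hs using BooleanSubalgebra.closure_bot_sup_induction with
  | mem t ht =>
    rcases ht with ⟨p, rfl⟩ | ⟨p, rfl⟩
    · by_cases hp : p = 0
      · left
        subst hp
        simp
      · right
        have hopen : IsOpen {y : Fin 1 → ℝ | MvPolynomial.aeval y p ≠ 0} :=
          isOpen_ne_fun (continuous_aeval_real p) continuous_const
        have hmem : {y : Fin 1 → ℝ | MvPolynomial.aeval y p ≠ 0} ∈ 𝓝 x :=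
          hopen.mem_nhds (hne p hp)
        simpa [compl_setOf] using hmem
    · by_cases hp : p = 0
      · right
        subst hp
        simp
      · rcases lt_or_gt_of_ne (hne p hp) with hlt | hgt
        · right
          have hopen : IsOpen {y : Fin 1 → ℝ | MvPolynomial.aeval y p < 0} :=
            isOpen_lt (continuous_aeval_real p) continuous_const
          filter_upwards [hopen.mem_nhds hlt] with y hy
          simp only [mem_compl_iff, mem_setOf_eq, not_lt]
          exact le_of_lt hy
        · left
          exact (isOpen_lt continuous_const (continuous_aeval_real p)).mem_nhds hgt
  | bot => exact Or.inr (by simp)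
  | sup t _ u _ iht ihu =>
    rcases iht with ht | ht
    · exact Or.inl (mem_of_superset ht subset_union_left)
    · rcases ihu with hu | hu
      · exact Or.inl (mem_of_superset hu subset_union_right)
      · right
        rw [show (t ⊔ u)ᶜ = tᶜ ∩ uᶜ from compl_union t u]
        exact inter_mem ht hu
  | compl t _ iht =>
    rcases iht with ht | ht
    · right
      simpa only [compl_compl] using ht
    · exact Or.inl ht

/-- **Fibres over `k`-points are `k`-semialgebraic**: for `k`-semialgebraic `V ⊆ ℝⁿ⁺¹` and
`a ∈ kⁿ` the fibre `{x ∈ ℝ¹ | (a, x 0) ∈ V}` is the preimage of `V` under the polynomial map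
`x ↦ (a₀, …, aₙ₋₁, x 0)` with coefficients in `k`. [cite: BochnakCosteRoy1998, §2.1] -/
theorem soloInformed_isSemialgebraic_fibre_snoc {n : ℕ} {V : Set (Fin (n + 1) → ℝ)}
    (hV : IsSemialgebraic k V) (a : Fin n → k) :
    IsSemialgebraic k {x : Fin 1 → ℝ | Fin.snoc (fun i => algebraMap k ℝ (a i)) (x 0) ∈ V} := by
  have h := hV.preimage_aeval (ι := Fin 1)
    (Fin.snoc (fun i => (MvPolynomial.C (a i) : MvPolynomial (Fin 1) k)) (MvPolynomial.X 0))
  refine (congrArg (IsSemialgebraic k) ?_).mpr h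
  ext x
  simp only [mem_setOf_eq, mem_preimage]
  refine Iff.of_eq (congrArg (· ∈ V) ?_)
  funext j
  refine Fin.lastCases ?_ (fun i => ?_) j
  · simp
  · simp

end Line

/-! ### Algebraic points of `K`- and `ℚ`-semialgebraic sets, `K = ℚ̄ ∩ ℝ` -/

/-- **A non-empty `K`-semialgebraic subset of the line contains an algebraic point**
(`K = integralClosure ℚ ℝ`, the real algebraic numbers as a subring of `ℝ`): a point of the set is
either algebraic, or transcendental over `ℚ` and hence over `K`, in which case the set is a
neighbourhood of it and contains a rational point. [cite: BochnakCosteRoy1998, §2.1] -/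
theorem soloInformed_exists_mem_isAlgebraic_line {s : Set (Fin 1 → ℝ)}
    (hs : IsSemialgebraic (integralClosure ℚ ℝ) s) (hne : s.Nonempty) :
    ∃ x ∈ s, IsAlgebraic ℚ (x 0) := by
  obtain ⟨x, hx⟩ := hne
  by_cases halg : IsAlgebraic ℚ (x 0)
  · exact ⟨x, hx, halg⟩
  · have htr : Transcendental (integralClosure ℚ ℝ) (x 0) :=
      Transcendental.integralClosure (R := ℚ) halg
    have hnhds : s ∈ 𝓝 x := by
      rcases soloInformed_nhds_or_compl_mem_nhds_of_transcendental htr hs with h | h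
      · exact h
      · exact absurd hx (mem_of_mem_nhds h)
    obtain ⟨ε, hε, hball⟩ := Metric.mem_nhds_iff.1 hnhds
    obtain ⟨q, hq₁, hq₂⟩ := exists_rat_btwn (show x 0 - ε < x 0 by linarith)
    refine ⟨fun _ => (q : ℝ), hball ?_, ?_⟩
    · rw [Metric.mem_ball, dist_pi_lt_iff hε]
      intro i
      rw [Subsingleton.elim i 0, Real.dist_eq, abs_lt]
      constructor <;> linarith
    · simpa using isAlgebraic_algebraMap (R := ℚ) (A := ℝ) q

/-- **Non-empty `K`-semialgebraic subsets of `ℝⁿ` have algebraic points**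
(`K = integralClosure ℚ ℝ`): induction on `n` through the projection (Tarski–Seidenberg over `K`)
and the fibre over the algebraic point found there — the semialgebraic shadow of `ℝ_alg ≼ ℝ`
(Basu–Pollack–Roy 2006, §2.5). [cite: BochnakCosteRoy1998, §5.2] -/
theorem soloInformed_exists_algebraic_point_K :
    ∀ (n : ℕ) (V : Set (Fin n → ℝ)), IsSemialgebraic (integralClosure ℚ ℝ) V → V.Nonempty →
      ∃ v ∈ V, ∀ i, IsAlgebraic ℚ (v i) := by
  intro n
  induction n with
  | zero => exact fun V _ ⟨v, hv⟩ => ⟨v, hv, fun i => i.elim0⟩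
  | succ n ih =>
    intro V hV hne
    obtain ⟨w, hw⟩ := hne
    obtain ⟨a, ⟨w', hw'V, rfl⟩, ha⟩ := ih _ (tarski_seidenberg_real_holds hV) ⟨_, w, hw, rfl⟩
    have hfib : IsSemialgebraic (integralClosure ℚ ℝ)
        {x : Fin 1 → ℝ | Fin.snoc (Fin.init w') (x 0) ∈ V} :=
      soloInformed_isSemialgebraic_fibre_snoc hV
        fun i => ⟨w' (Fin.castSucc i), (mem_integralClosure_iff ℚ ℝ).2 (ha i).isIntegral⟩
    have hfne : ({x : Fin 1 → ℝ | Fin.snoc (Fin.init w') (x 0) ∈ V}).Nonempty := by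
      refine ⟨fun _ => w' (Fin.last n), ?_⟩
      rw [mem_setOf_eq, Fin.snoc_init_self]
      exact hw'V
    obtain ⟨x, hx, hxalg⟩ := soloInformed_exists_mem_isAlgebraic_line hfib hfne
    refine ⟨_, hx, fun i => ?_⟩
    refine Fin.lastCases ?_ (fun j => ?_) i
    · simpa using hxalg
    · rw [Fin.snoc_castSucc]
      exact ha j

/-- **Non-empty `ℚ`-semialgebraic subsets of `ℝⁿ` have algebraic points**: a `ℚ`-semialgebraic
set (the domains and parameter loci of the tree's Kontsevich–Zagier calculus) is `K`-semialgebraic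
by base change, so `soloInformed_exists_algebraic_point_K` applies.
[cite: BochnakCosteRoy1998, §5.2] -/
theorem soloInformed_exists_algebraic_point {n : ℕ} {V : Set (Fin n → ℝ)}
    (hV : IsSemialgebraic ℚ V) (hne : V.Nonempty) : ∃ v ∈ V, ∀ i, IsAlgebraic ℚ (v i) :=
  soloInformed_exists_algebraic_point_K n V
    (soloInformed_isSemialgebraic_baseChange (integralClosure ℚ ℝ) hV) hne

/-- **Transfer of real parameters to algebraic parameters.** A `ℚ`-semialgebraic (by
Tarski–Seidenberg: any parameter-free first-order ordered-field) condition `P` on a real parameter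
vector which holds for SOME real vector holds for one with all coordinates algebraic over `ℚ` — the
step of the `KZ_ℝ` method barrier that turns an `ℝ`-parametrised configuration into a
`ℚ̄`-parametrised one with the same first-order properties. [cite: BochnakCosteRoy1998, §5.2] -/
theorem soloInformed_realParameter_transfer {m : ℕ} {P : (Fin m → ℝ) → Prop}
    (hP : IsSemialgebraic ℚ {c | P c}) {c : Fin m → ℝ} (hc : P c) :
    ∃ c' : Fin m → ℝ, P c' ∧ ∀ i, IsAlgebraic ℚ (c' i) :=
  soloInformed_exists_algebraic_point hP ⟨c, hc⟩

/-! ### `ℝ`-semialgebraic sets are fibres of `ℚ`-semialgebraic families -/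

/-- Restricting `(c₁ ++ c₂, x)` to the first parameter block gives `(c₁, x)`. [folklore] -/
theorem soloInformed_sumElim_append_comp_castAdd {m₁ m₂ n : ℕ} (c₁ : Fin m₁ → ℝ)
    (c₂ : Fin m₂ → ℝ) (x : Fin n → ℝ) :
    Sum.elim (Fin.append c₁ c₂) x ∘ Sum.map (Fin.castAdd m₂) id = Sum.elim c₁ x := by
  funext j
  cases j with
  | inl j => simp
  | inr j => simp

/-- Restricting `(c₁ ++ c₂, x)` to the second parameter block gives `(c₂, x)`. [folklore] -/
theorem soloInformed_sumElim_append_comp_natAdd {m₁ m₂ n : ℕ} (c₁ : Fin m₁ → ℝ)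
    (c₂ : Fin m₂ → ℝ) (x : Fin n → ℝ) :
    Sum.elim (Fin.append c₁ c₂) x ∘ Sum.map (Fin.natAdd m₁) id = Sum.elim c₂ x := by
  funext j
  cases j with
  | inl j => simp
  | inr j => simp

/-- **Spreading out real coefficients.** Every `p ∈ ℝ[X₁, …, Xₙ]` is a specialisation
`p(x) = Q(c, x)` of a polynomial `Q ∈ ℚ[C₁, …, C_m, X₁, …, Xₙ]` with RATIONAL coefficients at a
real parameter vector `c ∈ ℝᵐ` (induction on `p`: a constant `a` is `C₁` at `c = a`; sums
concatenate the parameter blocks; multiplication by a variable is inherited). [folklore] -/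
theorem soloInformed_exists_ratFamily_of_mvPolynomial {n : ℕ} (p : MvPolynomial (Fin n) ℝ) :
    ∃ (m : ℕ) (c : Fin m → ℝ) (Q : MvPolynomial (Fin m ⊕ Fin n) ℚ),
      ∀ x : Fin n → ℝ, MvPolynomial.aeval (Sum.elim c x) Q = MvPolynomial.eval x p := by
  induction p using MvPolynomial.induction_on with
  | C a =>
    refine ⟨1, fun _ => a, MvPolynomial.X (Sum.inl 0), fun x => ?_⟩
    simp
  | add p q hp hq =>
    obtain ⟨m₁, c₁, Q₁, h₁⟩ := hp
    obtain ⟨m₂, c₂, Q₂, h₂⟩ := hq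
    refine ⟨m₁ + m₂, Fin.append c₁ c₂,
      MvPolynomial.rename (Sum.map (Fin.castAdd m₂) id) Q₁ +
        MvPolynomial.rename (Sum.map (Fin.natAdd m₁) id) Q₂, fun x => ?_⟩
    rw [map_add, MvPolynomial.aeval_rename, MvPolynomial.aeval_rename,
      soloInformed_sumElim_append_comp_castAdd, soloInformed_sumElim_append_comp_natAdd, h₁, h₂,
      map_add]
  | mul_X p i hp =>
    obtain ⟨m, c, Q, h⟩ := hp
    refine ⟨m, c, Q * MvPolynomial.X (Sum.inr i), fun x => ?_⟩
    rw [map_mul, map_mul, h x, MvPolynomial.aeval_X, MvPolynomial.eval_X, Sum.elim_inr]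

/-- **`ℝ`-semialgebraic sets are the fibres of `ℚ`-semialgebraic families.** `s ⊆ ℝⁿ` is
`ℝ`-semialgebraic iff `s = {x | (c, x) ∈ S}` for some `m`, some real vector `c ∈ ℝᵐ` and some
`ℚ`-semialgebraic `S ⊆ ℝ^{m ⊕ n}` (`⟹`: induction over the generating Boolean algebra, generators
by `soloInformed_exists_ratFamily_of_mvPolynomial`, unions by concatenating parameter blocks;
`⟸`: the fibre is the preimage of the `ℝ`-semialgebraic `S` under the polynomial map
`x ↦ (c, x)`).  With `soloInformed_realParameter_transfer`: "an `ℝ`-semialgebraic configuration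
= a `ℚ`-semialgebraic family + one real parameter vector". [cite: BochnakCosteRoy1998, §2.2] -/
theorem soloInformed_isSemialgebraic_real_iff_fibre {n : ℕ} {s : Set (Fin n → ℝ)} :
    IsSemialgebraic ℝ s ↔ ∃ (m : ℕ) (c : Fin m → ℝ) (S : Set (Fin m ⊕ Fin n → ℝ)),
      IsSemialgebraic ℚ S ∧ s = {x | Sum.elim c x ∈ S} := by
  constructor
  · intro hs
    induction hs using BooleanSubalgebra.closure_bot_sup_induction with
    | mem t ht =>
      rcases ht with ⟨p, rfl⟩ | ⟨p, rfl⟩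
      · obtain ⟨m, c, Q, hQ⟩ := soloInformed_exists_ratFamily_of_mvPolynomial p
        refine ⟨m, c, {w | MvPolynomial.aeval w Q = 0}, isSemialgebraic_setOf_eval_eq_zero Q, ?_⟩
        ext x
        simp only [mem_setOf_eq, hQ x]
        rfl
      · obtain ⟨m, c, Q, hQ⟩ := soloInformed_exists_ratFamily_of_mvPolynomial p
        refine ⟨m, c, {w | 0 < MvPolynomial.aeval w Q}, isSemialgebraic_setOf_eval_pos Q, ?_⟩
        ext x
        simp only [mem_setOf_eq, hQ x]
        rfl
    | bot =>
      refine ⟨0, Fin.elim0, ∅, isSemialgebraic_empty, ?_⟩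
      ext x
      simp only [mem_setOf_eq, mem_empty_iff_false, iff_false]
      exact id
    | sup t _ u _ iht ihu =>
      obtain ⟨m₁, c₁, S₁, hS₁, rfl⟩ := iht
      obtain ⟨m₂, c₂, S₂, hS₂, rfl⟩ := ihu
      refine ⟨m₁ + m₂, Fin.append c₁ c₂,
        (fun w => w ∘ Sum.map (Fin.castAdd m₂) id) ⁻¹' S₁ ∪
          (fun w => w ∘ Sum.map (Fin.natAdd m₁) id) ⁻¹' S₂,
        (hS₁.preimage_comp _).union (hS₂.preimage_comp _), ?_⟩
      ext x
      simp only [sup_eq_union, mem_union, mem_preimage, mem_setOf_eq,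
        soloInformed_sumElim_append_comp_castAdd, soloInformed_sumElim_append_comp_natAdd]
    | compl t _ iht =>
      obtain ⟨m, c, S, hS, rfl⟩ := iht
      refine ⟨m, c, Sᶜ, hS.compl, ?_⟩
      ext x
      simp only [mem_compl_iff, mem_setOf_eq]
  · rintro ⟨m, c, S, hS, rfl⟩
    have hS' : IsSemialgebraic ℝ S := soloInformed_isSemialgebraic_baseChange ℝ hS
    have h := hS'.preimage_aeval (ι := Fin n)
      (Sum.elim (fun j => (MvPolynomial.C (c j) : MvPolynomial (Fin n) ℝ))
        fun i => MvPolynomial.X i)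
    refine (congrArg (IsSemialgebraic ℝ) ?_).mpr h
    ext x
    simp only [mem_setOf_eq, mem_preimage]
    refine Iff.of_eq (congrArg (· ∈ S) ?_)
    funext j
    cases j with
    | inl j => simp
    | inr j => simp

/-! ### The model-theoretic form: points with coordinates in the definable closure -/

section OMinimal

variable {L : FirstOrder.Language.{0, 0}} {M : Type*} [L.Structure M]

/-- **Fibres over a tuple of parameters are definable**: if `V ⊆ Mⁿ⁺¹` is `B`-definable and
`a ∈ Bⁿ`, the fibre `{t | (a, t) ∈ V}` is a `B`-definable subset of `M` (preimage of `V` under the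
definable map `t ↦ (a, t)`). [folklore] -/
theorem soloInformed_definable₁_fibre_snoc {B : Set M} {n : ℕ} {V : Set (Fin (n + 1) → M)}
    (hV : B.Definable L V) {a : Fin n → M} (ha : ∀ i, a i ∈ B) :
    B.Definable₁ L {t : M | Fin.snoc a t ∈ V} := by
  have hF : B.DefinableMap L (fun x : Fin 1 → M => (Fin.snoc a (x 0) : Fin (n + 1) → M)) := by
    intro i
    refine Fin.lastCases ?_ (fun j => ?_) i
    · simpa using definableFun_proj_params (L := L) (A := B) (0 : Fin 1)
    · simpa using definableFun_const_params (L := L) (Fin 1) (ha j)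
  exact hV.preimage_map hF

variable [Field M] [LinearOrder M] [IsStrictOrderedRing M]

/-- **Every non-empty `A`-definable subset of `Mⁿ` has a point with all coordinates in
`dcl(A)`**, for an o-minimal expansion `M` of an ordered field (van den Dries 1998, Ch. 6,
(1.2)–(1.3), definable Skolem functions; den Besten 2016, Lemma 4.4.2).  Induction on `n`: the
projection has such a point `a`; the fibre over `a` is a non-empty subset of the line definable
over `dcl(A)`, so it contains a point of `dcl(dcl(A)) = dcl(A)` (the tree's one-variable case
`exists_mem_definableClosure_of_nonempty_of_orderedField`).  For `M = ℝ` as an ordered field and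
`A ⊆ ℚ` this is `soloInformed_exists_algebraic_point` again, given the tree's `real_isOMinimal`
and `definable_iff_isSemialgebraic_real`. [cite: Dries1998, Ch. 6 (1.2)–(1.3)] -/
theorem soloInformed_exists_mem_forall_mem_definableClosure
    (φ : Language.orderedRing →ᴸ L) [φ.IsExpansionOn M] (hO : L.IsOMinimal M) (A : Set M) :
    ∀ (n : ℕ) (V : Set (Fin n → M)), A.Definable L V → V.Nonempty →
      ∃ v ∈ V, ∀ i, v i ∈ definableClosure L A := by
  intro n
  induction n with
  | zero => exact fun V _ ⟨v, hv⟩ => ⟨v, hv, fun i => i.elim0⟩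
  | succ n ih =>
    intro V hV hne
    obtain ⟨w, hw⟩ := hne
    obtain ⟨a, ⟨w', hw'V, rfl⟩, ha⟩ := ih _ (hV.image_comp Fin.castSucc) ⟨_, w, hw, rfl⟩
    have hVB : (definableClosure L A).Definable L V := hV.mono (subset_definableClosure A)
    have hS := soloInformed_definable₁_fibre_snoc hVB (a := Fin.init w') ha
    have hSne : ({t : M | Fin.snoc (Fin.init w') t ∈ V}).Nonempty := by
      refine ⟨w' (Fin.last n), ?_⟩
      rw [mem_setOf_eq, Fin.snoc_init_self]
      exact hw'V
    obtain ⟨c, hc, hcS⟩ :=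
      exists_mem_definableClosure_of_nonempty_of_orderedField φ hO hS hSne
    rw [definableClosure_definableClosure] at hc
    refine ⟨Fin.snoc (Fin.init w') c, hcS, fun i => ?_⟩
    refine Fin.lastCases ?_ (fun j => ?_) i
    · simpa using hc
    · rw [Fin.snoc_castSucc]
      exact ha j

end OMinimal

end Summit.KontsevichZagierPeriods.KontsevichZagierPeriods.Theorems
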